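import Literature.MathematicalPhysics.QuantumFieldTheory.Balaban1983to89.B9Cor35PDirAtCubeField

/-!
# `Balaban1983to89.B9Cor35PDirWordIdentity` — [Balaban1985BackgroundPropagators] (3.25) p. 394 ∕ p. 409 l. 1–5: THE DIRICHLET PROJECTION WORD ON THE CARRIER IS
# node00-def-Y's `P_□(Ṽ) = G′_□Q′*_□(Q′_□G′_□²Q′*_□)⁻¹Q′_□G′_□(Ṽ)` — `G̃ ∘ QcsR Ṽ ∘ CinvR Ṽ ∘ QcR Ṽ ∘ G̃ = conj b (PCubeDY i □ 𝔭 (GpDirY … Ω₀(□)) 𝔖 Ṽ|_ℝ)` for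
# `G̃ = conj b(η²(padΔ_{□,Ω₀}(Ṽ))⁻¹)` (the padding `1 − Ω₀` and the carrier projection `𝟙_𝔖` are invisible; the scale factors `η²·η⁻⁴·η²` cancel), hence
# ★★★ `cor35_PCubeDY_cube` : (3.76)–(3.77) for the realified difference `∇_Ṽ ∘ conj b P_□(Ṽ) ∘ ∇*_Ṽ − ∇_1 ∘ conj b P_□(1) ∘ ∇*_1` in def-Y's letters
# (ROAD (I) U6d; seat dag-n06-c g33)

statement-level skeleton of published theorems with citation tags; proofs where landed; nothing here is a claim about the Yang–Mills mass gap

## What this file does (mathematically)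

FILE `B9Cor35PDirAtCubeField.cor35_PDir_cube` states (3.77) for the carrier words `G̃ ∘ QcsR Ṽ ∘ CinvR Ṽ ∘ QcR Ṽ ∘ G̃`.  §1 ★★ `pword_eq`: for ANY field `Ṽ`
with `padΔ_{□,Ω₀}(Ṽ)` a unit this word is `conj b (PCubeDY … Ṽ |_ℝ)` — `(padΔ)⁻¹ = G′_□(Ṽ) + (1 − Ω₀)` (U6b-iv), `ext♯ ∘ res♯ = 𝟙_𝔖`, `𝟙_𝔖 C_□ 𝟙_𝔖 = C_□`
(def-Y's `dirInvY`), and the two support facts `(1 − Ω₀) ∘ Q′*_□(Ṽ) ∘ ext♯ = 0`, `res♯ ∘ Q′_□(Ṽ) ∘ (1 − Ω₀) = 0` (U6b-iv).  §2 ★★★ `cor35_PCubeDY_cube`: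
`cor35_PDir_cube` rewritten — at `Ṽ` with the unit from `cor35_CDir_cube`'s companion `GextDirK_eq_GpDirVK`, at `U = 1` with UNIT 1's
`isUnit_padDeltaCubeY_one_dirDomY` and `GpDirK = conj b(η²(padΔ(1))⁻¹)`.

## Status

Printed-statement pass + proof body (proof-backed; a port in the tree's vocabulary; operator algebra + assembly): [Balaban1985BackgroundPropagators] pp. 394,
403–409, re-read 2026-08-31.  Honest label: (3.77) for the cube's Dirichlet projection letter `PCubeDY` of node00-def-Y at the small field of a cut potential,
in conj-`b` form with r06's `gradLin ∕ divLin` at `UboxY`; `A`-dependent data displayed.  Node N06 of the `pub-ymgap` DAG is NOT discharged here and the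
Yang–Mills mass gap is NOT proved here.  NEW file; nothing landed is modified.  No `sorry`, no `axiom`, no `instance`, no `notation`.  Net new unproved
facts: 0.  Cell `pub-ymgap` (HUMAN RULING D-0062), node N06 [B9], seat `pub-ymgap-dag-n06-c` (g33), 2026-08-31.
RELATED, NOT DUPLICATED (searched 2026-08-31: `rg 'pword_eq|cor35_PCubeDY_cube'` = ∅): FILE `B9Cor35PDirAtCubeField` (USED BY NAME), n06-j
`B9Eq3105DirichletBondLettersAtOneY.PCubeDY_parKnitCubeY_GpDirY_one` (the `U = 1` matrix form of `PCubeDY`).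
-/

noncomputable section

namespace Literature.MathematicalPhysics.QuantumFieldTheory.Balaban1983to89.B9Cor35PDirWordIdentity

open B6KLevelCensusIndexV1 (KIdx kGeo)
open B6Cover236MultiLevelBlocks (cubes)
open B6RandomWalk (HasMajorant)
open B9Thm34Ext (toB6)
open B9Eq352DivFormLetters (conj)
open B9Eq376POneLetters (conjHom conjHom_comp conjHom_eq_conj gradLin divLin)
open B9Eq39Adjoint (covD covDstar)
open B9Eq352DivForm (tauB)
open B9CubeLettersOpsL0 (cubeFamY oddMh)
open B9CubeLettersBondOpsL0 (BlkCubeY qpKc qpsKc QpCubeY QpsCubeY)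
open B9Eq360DeltaPrimeAY (AfldY chartA)
open B9Eq360DeltaPrimeACubeY (blkCubeY kFCubeY sFCubeY)
open B9CubeGeometryInputs (geoCK RM1)
open B9Cor35GpCubeInputsAtOne (wK eta_ne_zero)
open B9Cor35GpDirInputsAtOne (dirDomY GpDirK isUnit_padDeltaCubeY_one_dirDomY)
open B9Cor36GpDirExtAtField (GextDirK_eq_GpDirVK)
open B9Cor35GpDirAtCubeLetters (cor35_GpDir_cube)
open B9Eq337CutFieldDirY (cutFldS cutCfgS)
open B9Eq360PadDeltaCubeYAgree (compr_sub_compr_eq_cutCfgS)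
open B9CubeSequence408Mirrors (mem_dirDomC_of_lev_pos)
open B9Cor35CDirCarrierAtOne (SBlk QcR QcsR CinvR)
open B9Cor35CDirPaddedCarrier (resOp extOp extOp_comp_resOp)
open B9Cor35CDirWordAtField (ringInverse_padDeltaCubeY_eq_add resOp_QpCubeY_cubeProjY cubeProjY_QpsCubeY_extOp)
open B9Cor35PDirAtCubeField (cor35_PDir_cube)
open Node00 (SiteY CfgY toKT shiftY UboxY liftMatY)
open Node00.OpsYLocalInverse (dirInvY cubeProjY cubeProjY_mul_cubeProjY mul_dirInvY dirInvY_mul)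
open Node00.OpsYCubeDirInverse (GpDirY padDeltaCubeY)
open Node00.OpsYCubeDirInverseBond (indProjY indProjY_mul_indProjY)
open Node00.OpsYCubeKnitPar (parKnitCubeY parKnitCubeY_one)
open Node00.OpsYCubeProjectionG (XinvCubeDY PCubeDY)

variable {d ℓ : ℕ} {hd : 1 ≤ d + 1} {hL : Odd (ℓ + 1) ∧ 1 < ℓ + 1} {b₀ b₁ : ℝ}
variable {𝔸 : Type} [NormedRing 𝔸] [NormedAlgebra ℂ 𝔸] [CompleteSpace 𝔸]
variable {ι : Type} [Fintype ι] (b : Module.Basis ι ℝ 𝔸)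

/-! ## §1 The carrier `P`-word is def-Y's `PCubeDY` -/

section Word

variable (i : KIdx d ℓ hd hL b₀ b₁) (c : ↥(cubes (toKT i).D.toDomains))

/-- ★★ **THE CARRIER PROJECTION WORD IS `conj b (P_□(Ṽ)|_ℝ)`**: for any field `Ṽ` with `padΔ_{□,Ω₀}(Ṽ)` a unit,
`G̃ ∘ QcsR Ṽ ∘ CinvR Ṽ ∘ QcR Ṽ ∘ G̃ = conj b (PCubeDY i □ 𝔭 (GpDirY … Ω₀(□)) 𝔖 Ṽ |_ℝ)`, `G̃ = conj b(η²(padΔ(Ṽ))⁻¹)`.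
[cite: Balaban1985BackgroundPropagators, (3.25) p.394, p.394 («Ω₀Δ′_aΩ₀»), p.409 l.1–5; Balaban1984PropagatorsII, (2.52) p.232] -/
theorem pword_eq (V : CfgY 𝔸 i) (hunit : IsUnit (padDeltaCubeY i c (parKnitCubeY i c) (dirDomY i c) V)) :
    conj b (((kGeo i).eta ^ 2) • (Ring.inverse (padDeltaCubeY i c (parKnitCubeY i c) (dirDomY i c) V)).restrictScalars ℝ) ∘ₗ
        QcsR b i c V ∘ₗ CinvR b i c V ∘ₗ QcR b i c V ∘ₗ
        conj b (((kGeo i).eta ^ 2) • (Ring.inverse (padDeltaCubeY i c (parKnitCubeY i c) (dirDomY i c) V)).restrictScalars ℝ) =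
      conj b ((PCubeDY i c (parKnitCubeY i c) (GpDirY i c (parKnitCubeY i c) (dirDomY i c)) (SBlk i c) V).restrictScalars ℝ) := by
  set P : Module.End ℂ (SiteY i → 𝔸) := cubeProjY i (dirDomY i c) with hPdef
  set G : Module.End ℂ (SiteY i → 𝔸) := GpDirY i c (parKnitCubeY i c) (dirDomY i c) V with hGdef
  set Xi : Module.End ℂ (BlkCubeY i c → 𝔸) := XinvCubeDY i c (parKnitCubeY i c) (GpDirY i c (parKnitCubeY i c) (dirDomY i c)) (SBlk i c) V with hXidef
  -- `𝟙_𝔖 C_□ = C_□ = C_□ 𝟙_𝔖`, with tails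
  have hP' : indProjY (𝔸 := 𝔸) (SBlk i c) * indProjY (SBlk i c) = indProjY (SBlk i c) := indProjY_mul_indProjY _
  have hXl : indProjY (SBlk i c) ∘ₗ Xi = Xi := by
    rw [← Module.End.mul_eq_comp, hXidef, XinvCubeDY, B9Eq3105DirichletBondLettersAtOneY.blkProjY_eq_indProjY i c (SBlk i c)]
    exact mul_dirInvY hP' _
  have hXr : Xi ∘ₗ indProjY (SBlk i c) = Xi := by
    rw [← Module.End.mul_eq_comp, hXidef, XinvCubeDY, B9Eq3105DirichletBondLettersAtOneY.blkProjY_eq_indProjY i c (SBlk i c)]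
    exact dirInvY_mul hP' _
  have hPX : ∀ {Y : Type} [AddCommGroup Y] [Module ℂ Y] (T : Y →ₗ[ℂ] (BlkCubeY i c → 𝔸)), indProjY (SBlk i c) ∘ₗ (Xi ∘ₗ T) = Xi ∘ₗ T :=
    fun T => by rw [← LinearMap.comp_assoc T Xi (indProjY (SBlk i c)), hXl]
  have hXP : ∀ {Y : Type} [AddCommGroup Y] [Module ℂ Y] (T : Y →ₗ[ℂ] (BlkCubeY i c → 𝔸)), Xi ∘ₗ (indProjY (SBlk i c) ∘ₗ T) = Xi ∘ₗ T :=
    fun T => by rw [← LinearMap.comp_assoc T (indProjY (SBlk i c)) Xi, hXr]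
  have hER : ∀ {Y : Type} [AddCommGroup Y] [Module ℂ Y] (T : Y →ₗ[ℂ] (BlkCubeY i c → 𝔸)),
      extOp (SBlk i c) ∘ₗ (resOp (SBlk i c) ∘ₗ T) = indProjY (SBlk i c) ∘ₗ T :=
    fun T => by rw [← LinearMap.comp_assoc T (resOp (SBlk i c)) (extOp (SBlk i c)), extOp_comp_resOp]
  -- the two support facts, with tails
  have hQE : (1 - P) ∘ₗ (QpsCubeY i c (parKnitCubeY i c) V ∘ₗ extOp (SBlk i c)) = 0 := by
    rw [LinearMap.sub_comp, Module.End.one_eq_id, LinearMap.id_comp, hPdef, cubeProjY_QpsCubeY_extOp, sub_self]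
  have hRQ : resOp (SBlk i c) ∘ₗ (QpCubeY i c (parKnitCubeY i c) V ∘ₗ (1 - P)) = 0 := by
    rw [LinearMap.comp_sub, Module.End.one_eq_id, LinearMap.comp_id, LinearMap.comp_sub, hPdef, resOp_QpCubeY_cubeProjY, sub_self]
  have hZ1 : ∀ (T : (SiteY i → 𝔸) →ₗ[ℂ] (BlkCubeY i c → 𝔸)), (1 - P) ∘ₗ (QpsCubeY i c (parKnitCubeY i c) V ∘ₗ (Xi ∘ₗ T)) = 0 := fun T => by
    calc (1 - P) ∘ₗ (QpsCubeY i c (parKnitCubeY i c) V ∘ₗ (Xi ∘ₗ T))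
        = (1 - P) ∘ₗ (QpsCubeY i c (parKnitCubeY i c) V ∘ₗ (extOp (SBlk i c) ∘ₗ (resOp (SBlk i c) ∘ₗ (Xi ∘ₗ T)))) := by rw [hER, hPX]
      _ = ((1 - P) ∘ₗ (QpsCubeY i c (parKnitCubeY i c) V ∘ₗ extOp (SBlk i c))) ∘ₗ (resOp (SBlk i c) ∘ₗ (Xi ∘ₗ T)) := by
          simp only [LinearMap.comp_assoc]
      _ = 0 := by rw [hQE, LinearMap.zero_comp]
  have hZ2 : Xi ∘ₗ (QpCubeY i c (parKnitCubeY i c) V ∘ₗ (1 - P)) = 0 := by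
    calc Xi ∘ₗ (QpCubeY i c (parKnitCubeY i c) V ∘ₗ (1 - P))
        = Xi ∘ₗ (extOp (SBlk i c) ∘ₗ (resOp (SBlk i c) ∘ₗ (QpCubeY i c (parKnitCubeY i c) V ∘ₗ (1 - P)))) := by rw [hER, hXP]
      _ = 0 := by rw [hRQ, LinearMap.comp_zero, LinearMap.comp_zero]
  -- the ℂ-linear composite
  have hC : Ring.inverse (padDeltaCubeY i c (parKnitCubeY i c) (dirDomY i c) V) ∘ₗ
      ((QpsCubeY i c (parKnitCubeY i c) V ∘ₗ extOp (SBlk i c)) ∘ₗ (resOp (SBlk i c) ∘ₗ Xi ∘ₗ extOp (SBlk i c)) ∘ₗ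
        (resOp (SBlk i c) ∘ₗ QpCubeY i c (parKnitCubeY i c) V)) ∘ₗ Ring.inverse (padDeltaCubeY i c (parKnitCubeY i c) (dirDomY i c) V) =
      PCubeDY i c (parKnitCubeY i c) (GpDirY i c (parKnitCubeY i c) (dirDomY i c)) (SBlk i c) V := by
    simp only [LinearMap.comp_assoc]
    simp only [hER, hPX, hXP]
    rw [ringInverse_padDeltaCubeY_eq_add i c V hunit, ← hGdef, ← hPdef]
    simp only [LinearMap.add_comp, LinearMap.comp_add, hZ2, add_zero, hZ1]
    rw [PCubeDY, ← hGdef, ← hXidef]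
  -- the conj-`b` bookkeeping
  rw [QcR, QcsR, CinvR, ← hXidef, ← conjHom_eq_conj, ← conjHom_eq_conj, ← conjHom_eq_conj, conjHom_comp, conjHom_comp, conjHom_comp, conjHom_comp]
  congr 1
  simp only [LinearMap.smul_comp, LinearMap.comp_smul, smul_smul]
  rw [← one_smul ℝ ((PCubeDY i c (parKnitCubeY i c) (GpDirY i c (parKnitCubeY i c) (dirDomY i c)) (SBlk i c) V).restrictScalars ℝ)]
  congr 1
  · have hcf : (|i.cf| : ℝ) ≠ 0 := abs_ne_zero.2 i.hcf
    field_simp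
  · exact congrArg (LinearMap.restrictScalars ℝ) hC

end Word

/-! ## §2 ★★★ (3.76)–(3.77) for def-Y's Dirichlet projection letter -/

set_option maxRecDepth 16384 in
/-- ★★★ **(3.76)–(3.77) ∕ COR. 3.5–3.6 FOR node00-def-Y's DIRICHLET PROJECTION LETTER `P_□ = PCubeDY i □ 𝔭 (GpDirY … Ω₀(□)) 𝔖` AT THE SMALL FIELD OF A CUT
POTENTIAL**: the realified difference `∇_Ṽ ∘ conj b(P_□(Ṽ)) ∘ ∇*_Ṽ − ∇_1 ∘ conj b(P_□(1)) ∘ ∇*_1` has the block majorant `K·α₁·ℓ(a)⁻²·e^{−δd(a,a′)}` over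
`(toB6 (geoCK i □) Rr H, q ↦ blkCubeY(q.1.2))`, uniformly in the member and the cover cube (hypotheses as in `cor35_PDir_cube`).
[cite: Balaban1985BackgroundPropagators, (3.76)–(3.77) pp.405–406, (3.25) p.394, Cor. 3.5 p.407, Cor. 3.6 p.408, p.409 l.1–5; Balaban1984PropagatorsII, Lemma 2.1 p.234, (2.51)–(2.52) p.232] -/
theorem cor35_PCubeDY_cube [DecidableEq ι] (d ℓ : ℕ) (hℓ : 1 ≤ ℓ) (Cq M₂ : ℝ) (hCq : 0 ≤ Cq) (hM₂ : 0 ≤ M₂) (hrepr : ∀ (v : 𝔸) (j : ι), |b.repr v j| ≤ M₂ * ‖v‖)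
    (h1 : ‖(1 : 𝔸)‖ ≤ 1) :
    ∃ δ M₀ T₀ : ℝ, ∃ N₀ : ℕ, 0 < δ ∧ ∃ a₁ : ℝ, 0 < a₁ ∧ ∃ K : ℝ, 0 ≤ K ∧
    ∀ {hd : 1 ≤ d + 1} {hL : Odd (ℓ + 1) ∧ 1 < ℓ + 1} {b₀ b₁ : ℝ} (i : KIdx d ℓ hd hL b₀ b₁) (c : ↥(cubes (toKT i).D.toDomains)) (Rr : ℝ) (H : Prop),
      M₀ ≤ ((ℓ : ℝ) + 1) * (toKT i).Mh → N₀ + 1 ≤ (toKT i).R * ((ℓ + 1) * (toKT i).Mh) → T₀ ≤ RM1 i →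
    ∀ (α₁ : ℝ), 0 ≤ α₁ → α₁ ≤ a₁ →
    ∀ (A : AfldY 𝔸 i),
      (∀ y x, blkCubeY i c x = y →
        ‖kFCubeY i c (parKnitCubeY i c) (fun _ _ => 1) (cutCfgS i (dirDomY i c) (kGeo i).eta A) y x‖ ≤ Cq * α₁ * wK i c y) →
      (∀ x, ‖sFCubeY i c (parKnitCubeY i c) (fun _ _ => 1) (cutCfgS i (dirDomY i c) (kGeo i).eta A) x‖ ≤ Cq * α₁) →
      (∀ ν k x, ‖(((geoCK i c).eta : ℂ)⁻¹) • covDstar (shiftY i) (fun _ _ => (1 : 𝔸ˣ)) ν (chartA i (cutFldS i (dirDomY i c) A) k) x‖ ≤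
        α₁ * ((geoCK i c).len (blkCubeY i c x) ^ 2)⁻¹) →
      (∀ μ ν x, ‖(((geoCK i c).eta : ℂ)⁻¹) • covD (shiftY i) (fun _ _ => (1 : 𝔸ˣ)) μ (chartA i (cutFldS i (dirDomY i c) A) ν) x‖ ≤
        α₁ * ((geoCK i c).len (blkCubeY i c x) ^ 2)⁻¹) →
      (∀ μ x, ‖(((geoCK i c).eta : ℂ)⁻¹) • covDstar (shiftY i) (fun _ _ => (1 : 𝔸ˣ)) μ
          (tauB (shiftY i) (fun _ _ => (1 : 𝔸ˣ)) μ (chartA i (cutFldS i (dirDomY i c) A) μ)) x‖ ≤ α₁ * ((geoCK i c).len (blkCubeY i c x) ^ 2)⁻¹) →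
      (∀ k x, ‖chartA i (cutFldS i (dirDomY i c) A) k x‖ ≤ α₁ * ((geoCK i c).len (blkCubeY i c x))⁻¹) →
      (∀ ν k x, ‖tauB (shiftY i) (fun _ _ => (1 : 𝔸ˣ)) ν (chartA i (cutFldS i (dirDomY i c) A) k) x‖ ≤ α₁ * ((geoCK i c).len (blkCubeY i c x))⁻¹) →
      (∀ z w : SiteY i, ‖(parKnitCubeY i c (cutCfgS i (dirDomY i c) (kGeo i).eta A) z w : 𝔸)‖ ≤ 1 ∧
        ‖(((parKnitCubeY i c (cutCfgS i (dirDomY i c) (kGeo i).eta A) z w)⁻¹ : 𝔸ˣ) : 𝔸)‖ ≤ 1) →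
      (∀ (s : BlkCubeY i c) (lam : SiteY i → 𝔸),
        ‖(QpCubeY i c (parKnitCubeY i c) (cutCfgS i (dirDomY i c) (kGeo i).eta A) lam - QpCubeY i c (parKnitCubeY i c) (fun _ _ => 1) lam) s‖ ≤
          Cq * α₁ * ∑ z, |qpKc i c s z| * ‖lam z‖) →
      (∀ (z : SiteY i) (nu : BlkCubeY i c → 𝔸),
        ‖(QpsCubeY i c (parKnitCubeY i c) (cutCfgS i (dirDomY i c) (kGeo i).eta A) nu - QpsCubeY i c (parKnitCubeY i c) (fun _ _ => 1) nu) z‖ ≤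
          Cq * α₁ * ∑ s, |qpsKc i c z s| * ‖nu s‖) →
      HasMajorant (g := toB6 (geoCK i c) Rr H) (fun q : (Fin (d + 1) × SiteY i) × ι => blkCubeY i c q.1.2)
        (conjHom b (gradLin (shiftY i) (((geoCK i c).eta : ℂ)⁻¹) (UboxY i (cutCfgS i (dirDomY i c) (kGeo i).eta A))) ∘ₗ
            conj b ((PCubeDY i c (parKnitCubeY i c) (GpDirY i c (parKnitCubeY i c) (dirDomY i c)) (SBlk i c)
              (cutCfgS i (dirDomY i c) (kGeo i).eta A)).restrictScalars ℝ) ∘ₗ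
            conjHom b (divLin (shiftY i) (((geoCK i c).eta : ℂ)⁻¹) (UboxY i (cutCfgS i (dirDomY i c) (kGeo i).eta A))) -
          conjHom b (gradLin (shiftY i) (((geoCK i c).eta : ℂ)⁻¹) (fun _ _ => (1 : 𝔸ˣ))) ∘ₗ
            conj b ((PCubeDY i c (parKnitCubeY i c) (GpDirY i c (parKnitCubeY i c) (dirDomY i c)) (SBlk i c) (fun _ _ => 1)).restrictScalars ℝ) ∘ₗ
            conjHom b (divLin (shiftY i) (((geoCK i c).eta : ℂ)⁻¹) (fun _ _ => (1 : 𝔸ˣ))))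
        (fun a a' => K * α₁ * ((geoCK i c).len a ^ 2)⁻¹ * Real.exp (-(δ * (geoCK i c).dist a a'))) := by
  obtain ⟨δ, M₀, T₀, N₀, hδ, a₁, ha₁, K, hK, hP⟩ := cor35_PDir_cube b d ℓ hℓ Cq M₂ hCq hM₂ hrepr h1
  -- the word laws of UNIT 2 (d) give the unit at `Ṽ` (n06-a); same thresholds suffice after enlarging
  obtain ⟨δG, BG, MG, TG, NG, -, -, aG, haG, BB, -, hG⟩ := cor35_GpDir_cube b d ℓ hℓ Cq M₂ hCq hM₂ hrepr h1
  refine ⟨δ, max M₀ MG, max T₀ TG, max N₀ NG, hδ, min a₁ aG, lt_min ha₁ haG, K, hK, ?_⟩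
  intro hd hL b₀ b₁ i c Rr H hM hN hT α₁ hα0 hα1 A hkF hsF h337B h337F h337Bτ hA hAτB hparV hF hFs
  have hM0 : M₀ ≤ ((ℓ : ℝ) + 1) * (toKT i).Mh := (le_max_left _ _).trans hM
  have hMG : MG ≤ ((ℓ : ℝ) + 1) * (toKT i).Mh := (le_max_right _ _).trans hM
  have hN0 : N₀ + 1 ≤ (toKT i).R * ((ℓ + 1) * (toKT i).Mh) := le_trans (Nat.succ_le_succ (le_max_left _ _)) hN
  have hNG : NG + 1 ≤ (toKT i).R * ((ℓ + 1) * (toKT i).Mh) := le_trans (Nat.succ_le_succ (le_max_right _ _)) hN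
  have hT0 : T₀ ≤ RM1 i := (le_max_left _ _).trans hT
  have hTG : TG ≤ RM1 i := (le_max_right _ _).trans hT
  obtain ⟨-, -, -, -, hrest⟩ := hG i c Rr H (parKnitCubeY i c) (parKnitCubeY_one i c) hMG hNG hTG
  obtain ⟨hw1, hw2, -, -⟩ := hrest α₁ hα0 (hα1.trans (min_le_right _ _)) (chartA i (cutFldS i (dirDomY i c) A))
    (kFCubeY i c (parKnitCubeY i c) (fun _ _ => 1) (cutCfgS i (dirDomY i c) (kGeo i).eta A))
    (sFCubeY i c (parKnitCubeY i c) (fun _ _ => 1) (cutCfgS i (dirDomY i c) (kGeo i).eta A)) hkF hsF h337B h337F h337Bτ hA hAτB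
  have hS1 : ∀ z : SiteY i, 1 ≤ B9CubeLettersOpsL0.levCubeY i c z → z ∈ dirDomY i c := fun z hz =>
    mem_dirDomC_of_lev_pos hL.1 (oddMh i) (toKT i).hMh (toKT i).hP c hz
  obtain ⟨hunitV, -⟩ := GextDirK_eq_GpDirVK b i c (parKnitCubeY i c) A (compr_sub_compr_eq_cutCfgS i c hS1 (kGeo i).eta A) hw1 hw2
  have hunit1 : IsUnit (padDeltaCubeY i c (parKnitCubeY i c) (dirDomY i c) (fun _ _ => (1 : 𝔸ˣ))) :=
    isUnit_padDeltaCubeY_one_dirDomY i c (parKnitCubeY i c) (parKnitCubeY_one i c)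
  have hm := hP i c Rr H hM0 hN0 hT0 α₁ hα0 (hα1.trans (min_le_left _ _)) A hkF hsF h337B h337F h337Bτ hA hAτB hparV hF hFs
  have hGp1 : GpDirK b i c (parKnitCubeY i c) =
      conj b (((kGeo i).eta ^ 2) • (Ring.inverse (padDeltaCubeY i c (parKnitCubeY i c) (dirDomY i c) (fun _ _ => (1 : 𝔸ˣ)))).restrictScalars ℝ) := rfl
  rw [hGp1] at hm
  simp only [LinearMap.comp_assoc] at hm
  rw [show conj b (((kGeo i).eta ^ 2) • (Ring.inverse (padDeltaCubeY i c (parKnitCubeY i c) (dirDomY i c)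
        (cutCfgS i (dirDomY i c) (kGeo i).eta A))).restrictScalars ℝ) ∘ₗ QcsR b i c (cutCfgS i (dirDomY i c) (kGeo i).eta A) ∘ₗ
        CinvR b i c (cutCfgS i (dirDomY i c) (kGeo i).eta A) ∘ₗ QcR b i c (cutCfgS i (dirDomY i c) (kGeo i).eta A) ∘ₗ
        conj b (((kGeo i).eta ^ 2) • (Ring.inverse (padDeltaCubeY i c (parKnitCubeY i c) (dirDomY i c)
          (cutCfgS i (dirDomY i c) (kGeo i).eta A))).restrictScalars ℝ) ∘ₗ
        conjHom b (divLin (shiftY i) (((geoCK i c).eta : ℂ)⁻¹) (UboxY i (cutCfgS i (dirDomY i c) (kGeo i).eta A))) =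
      conj b ((PCubeDY i c (parKnitCubeY i c) (GpDirY i c (parKnitCubeY i c) (dirDomY i c)) (SBlk i c)
        (cutCfgS i (dirDomY i c) (kGeo i).eta A)).restrictScalars ℝ) ∘ₗ
        conjHom b (divLin (shiftY i) (((geoCK i c).eta : ℂ)⁻¹) (UboxY i (cutCfgS i (dirDomY i c) (kGeo i).eta A))) by
      rw [← pword_eq b i c _ hunitV]; simp only [LinearMap.comp_assoc],
    show conj b (((kGeo i).eta ^ 2) • (Ring.inverse (padDeltaCubeY i c (parKnitCubeY i c) (dirDomY i c) (fun _ _ => (1 : 𝔸ˣ)))).restrictScalars ℝ) ∘ₗ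
        QcsR b i c (fun _ _ => 1) ∘ₗ CinvR b i c (fun _ _ => 1) ∘ₗ QcR b i c (fun _ _ => 1) ∘ₗ
        conj b (((kGeo i).eta ^ 2) • (Ring.inverse (padDeltaCubeY i c (parKnitCubeY i c) (dirDomY i c) (fun _ _ => (1 : 𝔸ˣ)))).restrictScalars ℝ) ∘ₗ
        conjHom b (divLin (shiftY i) (((geoCK i c).eta : ℂ)⁻¹) (fun _ _ => (1 : 𝔸ˣ))) =
      conj b ((PCubeDY i c (parKnitCubeY i c) (GpDirY i c (parKnitCubeY i c) (dirDomY i c)) (SBlk i c) (fun _ _ => 1)).restrictScalars ℝ) ∘ₗ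
        conjHom b (divLin (shiftY i) (((geoCK i c).eta : ℂ)⁻¹) (fun _ _ => (1 : 𝔸ˣ))) by
      rw [← pword_eq b i c _ hunit1]; simp only [LinearMap.comp_assoc]] at hm
  simpa only [LinearMap.comp_assoc] using hm

end Literature.MathematicalPhysics.QuantumFieldTheory.Balaban1983to89.B9Cor35PDirWordIdentity
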